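import Summits.CriticalPhenomena.PercolationContinuityZ3.Theorems.Transplant.CayleyMilnorGlide
import HarnessLib

/-!
# Milnor's kernel lemma, X: the other side of the screw/glide criterion — for a SCREW (`M` fixes no nonzero additive functional) EVERY homomorphism
# `ℤ² ⋊_M ℤ → ℤ²` has rank `≤ 1`, so the glide-group route of file VI yields nothing (the multi-type wall (d′), group-theoretically certified)

builds on p205010 (kernel theorem, internal audit signed; external expert review pending) — nothing in this file uses p205010; pure group theory,
no percolation.  Lane `prim-bschramm`, seat `prim-bschramm-p4` gen 18 (PART C3 of `P4-GENERAL.md` §40.2/§40.4).  Helper file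
(`--supports stmt-CriticalPhenomena-4575`).

File VI (`Glide3.criticalContinuity`) closes a layered net modulo the scaled node as soon as the linear part `M : ℤ² ≃+ ℤ²` of its affine step FIXES a
nonzero additive functional `ℓ` (glides, mirrors).  Here the converse bookkeeping: if `M` fixes NO nonzero additive functional — every screw rotation of
order `≥ 2`, e.g. p2's layer swap `(i, j, z) ↦ (−i, −j, z + 1)` of hcp (`M = −1`) — then every homomorphism `c : ℤ² ⋊_M ℤ → ℤ²` kills the translation
subgroup `ℤ²` (its restriction is an `M`-invariant pair of functionals, `Glide3.toAdd_chi_inl_eq_zero`), hence factors through the height `ℤ`, and any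
two values are proportional: **`Glide3.det2_eq_zero_of_noInvariant : MaxArea.det2 (c a) (c b) = 0`** — no rank-2 character, `b₁(ℤ² ⋊_M ℤ) ≤ 1`.  This is
the group form of §39.4's multi-type wall (d′) for the glide group itself (it says nothing about OTHER transitive groups of a given net; for 3-periodic
nets the R-level statement `b₁(Γ) = dim Fix(P_Γ)` of §40.4 covers all crystallographic subgroups).
[cite: BenjaminiSchramm1996, Conj. 4; §2] [cite: MilnorSolvableGrowth1968, Lemma 1]
-/

noncomputable section

namespace Summit.CriticalPhenomena.PercolationContinuityZ3.Theorems.Transplant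

open Literature.Probability.LatticeModels

namespace Glide3

variable (M : Site 2 ≃+ Site 2)

/-- **A homomorphism `ℤ² ⋊_M ℤ → ℤ²` restricted to the translations is `M`-invariant**: `(M u, 0) = (0,1)(u,0)(0,1)⁻¹` (Mathlib
`SemidirectProduct.inl_aut`) and the target is commutative. [folklore] -/
theorem chi_inl_M (c : Grp M →* Multiplicative (Site 2)) (u : Site 2) : c (elt M (M u) 0) = c (elt M u 0) := by
  have e : rot M (Multiplicative.ofAdd (1 : ℤ)) (Multiplicative.ofAdd u) = Multiplicative.ofAdd (M u) := by
    apply Multiplicative.toAdd.injective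
    rw [toAdd_rot, toAdd_ofAdd, toAdd_ofAdd, toAdd_ofAdd, Mz_one]
  have h := SemidirectProduct.inl_aut (φ := rot M) (Multiplicative.ofAdd (1 : ℤ)) (Multiplicative.ofAdd u)
  rw [e] at h
  show c (SemidirectProduct.inl (Multiplicative.ofAdd (M u))) = c (SemidirectProduct.inl (Multiplicative.ofAdd u))
  rw [h, map_mul, map_mul, mul_right_comm, ← map_mul c, ← map_mul (SemidirectProduct.inr : Multiplicative ℤ →* Grp M), mul_inv_cancel,
    map_one, map_one, one_mul]

/-- The `i`-th coordinate of `c` on the translations, as an additive functional `ℤ² → ℤ`. [folklore] -/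
def coordFun (c : Grp M →* Multiplicative (Site 2)) (i : Fin 2) : Site 2 →+ ℤ where
  toFun u := (c (elt M u 0)).toAdd i
  map_zero' := by
    rw [show elt M (0 : Site 2) 0 = 1 from rfl, map_one, toAdd_one, Pi.zero_apply]
  map_add' u v := by
    rw [show elt M (u + v) 0 = elt M u 0 * elt M v 0 from ?_, map_mul, toAdd_mul, Pi.add_apply]
    refine (SemidirectProduct.inl (φ := rot M)).map_mul (Multiplicative.ofAdd u) (Multiplicative.ofAdd v) ▸ ?_
    rfl

/-- The coordinate functionals are `M`-invariant. [folklore] -/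
theorem coordFun_M (c : Grp M →* Multiplicative (Site 2)) (i : Fin 2) (u : Site 2) : coordFun M c i (M u) = coordFun M c i u := by
  show (c (elt M (M u) 0)).toAdd i = (c (elt M u 0)).toAdd i
  rw [chi_inl_M]

/-- **If `M` fixes no nonzero additive functional, every homomorphism `ℤ² ⋊_M ℤ → ℤ²` kills the translations.** [folklore] -/
theorem toAdd_chi_inl_eq_zero (hM : ∀ ℓ : Site 2 →+ ℤ, (∀ v, ℓ (M v) = ℓ v) → ℓ = 0) (c : Grp M →* Multiplicative (Site 2)) (u : Site 2) :
    (c (elt M u 0)).toAdd = 0 := by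
  funext i
  have h := hM (coordFun M c i) (coordFun_M M c i)
  have := DFunLike.congr_fun h u
  exact this

/-- Values on the height generator's powers: `c (0, k) = k • c (0, 1)`. [folklore] -/
theorem toAdd_chi_elt_zero (c : Grp M →* Multiplicative (Site 2)) (k : ℤ) :
    (c (elt M 0 k)).toAdd = k • (c (elt M 0 1)).toAdd := by
  have e : elt M 0 k = (elt M 0 1) ^ k := by
    have : (SemidirectProduct.inr (Multiplicative.ofAdd k) : Grp M) = SemidirectProduct.inr (Multiplicative.ofAdd (1 : ℤ)) ^ k := by
      rw [← map_zpow, ← Int.ofAdd_mul, one_mul]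
    exact this
  rw [e, map_zpow, toAdd_zpow]

/-- **Every value of `c` is a multiple of `w := c (0, 1)`** when `M` fixes no nonzero functional: `c (u, k) = k • w`. [folklore] -/
theorem toAdd_chi_eq_smul (hM : ∀ ℓ : Site 2 →+ ℤ, (∀ v, ℓ (M v) = ℓ v) → ℓ = 0) (c : Grp M →* Multiplicative (Site 2)) (a : Grp M) :
    (c a).toAdd = ht M a • (c (elt M 0 1)).toAdd := by
  have e : a = elt M (tr M a) 0 * elt M 0 (ht M a) := (SemidirectProduct.inl_left_mul_inr_right a).symm
  rw [e, map_mul, toAdd_mul, toAdd_chi_inl_eq_zero M hM, zero_add, toAdd_chi_elt_zero, ht_mul, ht_elt, ht_elt, zero_add]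

/-- **THEOREM (screws give no rank-2 character).**  If `M : ℤ² ≃+ ℤ²` fixes no nonzero additive functional, then for every homomorphism
`c : ℤ² ⋊_M ℤ → ℤ²` and all `a, b`, `det(c a, c b) = 0`: the image of `c` is cyclic, `b₁(ℤ² ⋊_M ℤ) ≤ 1`, and the hypothesis `hrank` of
`AutScaled.criticalContinuity` / `Glide3.criticalContinuity` is unavailable through this group. [cite: BenjaminiSchramm1996, Conj. 4; §2] -/
theorem det2_eq_zero_of_noInvariant (hM : ∀ ℓ : Site 2 →+ ℤ, (∀ v, ℓ (M v) = ℓ v) → ℓ = 0) (c : Grp M →* Multiplicative (Site 2))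
    (a b : Grp M) : MaxArea.det2 (c a).toAdd (c b).toAdd = 0 := by
  rw [toAdd_chi_eq_smul M hM c a, toAdd_chi_eq_smul M hM c b, MaxArea.det2]
  simp only [Pi.smul_apply, smul_eq_mul]
  ring

/-- **Example: the 2₁ screw `M = −1`** (p2's hcp layer swap `(i,j,z) ↦ (−i,−j,z+1)`) fixes no nonzero functional, so its screw group `ℤ² ⋊_{−1} ℤ` has
no rank-2 character — whereas the `c`-glide of file VII does (`Hcp.criticalContinuity_of_frmScaledNode₁`). [folklore] -/
theorem noInvariant_neg : ∀ ℓ : Site 2 →+ ℤ, (∀ v, ℓ ((AddEquiv.neg (Site 2)) v) = ℓ v) → ℓ = 0 := by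
  intro ℓ hℓ
  refine AddMonoidHom.ext fun v => ?_
  have h := hℓ v
  rw [AddEquiv.neg_apply, map_neg] at h
  show ℓ v = 0
  omega

/-- The screw group `ℤ² ⋊_{−1} ℤ` admits no rank-2 homomorphism to `ℤ²`. [folklore] -/
theorem det2_eq_zero_screw (c : Grp (AddEquiv.neg (Site 2)) →* Multiplicative (Site 2)) (a b : Grp (AddEquiv.neg (Site 2))) :
    MaxArea.det2 (c a).toAdd (c b).toAdd = 0 :=
  det2_eq_zero_of_noInvariant _ noInvariant_neg c a b

end Glide3

end Summit.CriticalPhenomena.PercolationContinuityZ3.Theorems.Transplant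

end
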